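import Summits.CriticalPhenomena.PercolationContinuityZ3.Theorems.PercNearOneGluingNoHeavyQuantTargetPropertyAt
import HarnessLib

/-!
# QUANT lane (R2), statements: the target property restricted to TRANSVERSALLY BOUNDED subboxes

builds on p205010 (kernel theorem, internal audit signed; external expert review pending)

Cell `prim-quant` (post-continuity programme, LANE 1), seat `prim-quant-p2` (METHOD = effective Kozma–Nitzan
reduction), memo `run/shared/lean/prim/quant/P2-EFFECTIVE-KN.md` §1–§3.

Why this variant exists.  `Quant.TargetPropertyAt d p ε δ H R` (typer file `…QuantTargetPropertyAt.lean`, the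
matrix of Kozma–Nitzan's Lemma 10) quantifies over ALL lattice subboxes `D` and all targets `T` whose routes have
scales `ℓ ≥ R` (`KozmaNitzan.IsTarget`), with no upper bound on `ℓ`.  Proving it from finite-volume inputs at
parameter `p` therefore needs the hittability of the geometries of `H` at EVERY scale `ℓ ≥ ℓmax` — a hypothesis
that is false at `p = p_c` (`θ(p_c) = 0`, p205010), which makes the contrapositive of an effective Theorem 6 vacuous
there.  Every subbox `D` to which Kozma–Nitzan's §4 applies the lemma is a box of bounded width transversally to one
axis (the regions of Lemma 11, the cubes and corridors of Lemma 12, the boxes `E_{v,x} ∖ E^j_{v,x}` of the scheme),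
and a route `v + ℓQ ⊆ D` of a quarter-face or elongated-box geometry then has `ℓ ≤` that width.  Restricting the
property to such `D` (`TargetPropertyThinAt … w`) lets it be proved from hittability on the BOUNDED scale range
`[ℓmax, w]` (`Quant.targetLemma_thin`, file `…QuantTargetLemmaThin.lean`) while still serving every application.

* `Quant.TargetPropertyThinAt d p ε δ H R w` — `TargetPropertyAt` with the extra hypothesis that `D` lies in a slab
  `{|y_i − c_i| ≤ w for all i ≠ a}` for some axis `a` and centre `c`;
* `Quant.TargetPropertyAt.thin` — the unrestricted property implies the restricted one (every `w`).
No proofs of substance; no sorries.  [cite: KozmaNitzan2024, §4 Lemma 10 (p. 17) and p. 16 (targets)]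
-/

noncomputable section

namespace Summit.CriticalPhenomena.PercolationContinuityZ3.Theorems.Quant

open Literature.Probability.LatticeModels Literature.Probability.Percolation
open Literature.Probability.Percolation.KozmaNitzan

/-- **Kozma–Nitzan's target property at `(ε, δ, H, R)` for transversally bounded subboxes of half-width `w`**:
the matrix of `KozmaNitzan.TargetProperty d p` (KN Lemma 10: on a finitely supported weighting `W` with a lattice
subbox `D ⊇ B⟨R⟩` at parameter `p`, `B = Icc lo hi`, for a nonempty target `T ⊆ D` w.r.t. `(B, D, R, H)` and a source
`o ∉ D`, `P_W(o ↔ B) > 1 − δ ⟹ P_W(o ↔ T) > 1 − ε`), demanded only for subboxes `D` contained in a slab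
`{y : c_i − w ≤ y_i ≤ c_i + w for every i ≠ a}` for some axis `a` and centre `c` — the shape of every subbox of
KN §4 (regions of Lemma 11, cubes/corridors of Lemma 12, `E_{v,x} ∖ E^j_{v,x}` of the exploration).  Monotone in
`w` (larger `w` = stronger); `TargetPropertyAt d p ε δ H R` implies it for every `w` (`TargetPropertyAt.thin`).
builds on p205010 (kernel theorem, internal audit signed; external expert review pending).
[cite: KozmaNitzan2024, §4 Lemma 10 (p. 17); p. 15 (boxes) and p. 16 (targets)] -/
def TargetPropertyThinAt (d : ℕ) (p : unitInterval) (ε δ : ℝ) (H : List (Geom d)) (R w : ℕ) : Prop :=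
  ∀ (W : Sym2 (Site d) → unitInterval) (Sfin D : Finset (Site d)) (lo hi : Site d)
    (T : Finset (Site d)) (o : Site d),
    FinSupp W Sfin → IsSubbox W p D → D ⊆ Sfin → o ∈ Sfin → o ∉ D →
    (∃ (a : Fin d) (c : Site d), ∀ y ∈ D, ∀ i : Fin d, i ≠ a → c i - (w : ℤ) ≤ y i ∧ y i ≤ c i + (w : ℤ)) →
    Finset.Icc (lo - (R : Site d)) (hi + (R : Site d)) ⊆ D →
    IsTarget T lo hi D R H → T ⊆ D → T.Nonempty →
    1 - δ < (prodBernoulli W).real (⋃ b ∈ Finset.Icc lo hi, openConn o b) →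
      1 - ε < (prodBernoulli W).real (⋃ t ∈ T, openConn o t)

/-- The unrestricted target property implies the transversally bounded one, for every half-width `w`.
builds on p205010 (kernel theorem, internal audit signed; external expert review pending).
[cite: KozmaNitzan2024, §4 Lemma 10 (p. 17)] -/
theorem TargetPropertyAt.thin {d : ℕ} {p : unitInterval} {ε δ : ℝ} {H : List (Geom d)} {R : ℕ}
    (h : TargetPropertyAt d p ε δ H R) (w : ℕ) : TargetPropertyThinAt d p ε δ H R w :=
  fun W Sfin D lo hi T o hfin hsub hDS ho hoD _ hBR htgt hTD hTne hreach =>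
    h W Sfin D lo hi T o hfin hsub hDS ho hoD hBR htgt hTD hTne hreach

end Summit.CriticalPhenomena.PercolationContinuityZ3.Theorems.Quant

end
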